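import Literature.NumberTheory.ModularSymbols.FullLevelHomologyHeckeTransfer
import Literature.NumberTheory.ModularSymbols.FullLevelHomologyComplexConj
import Literature.NumberTheory.ModularSymbols.CuspidalHomologyHeckeRepIndependence
import Mathlib.RingTheory.PrincipalIdealDomain
import HarnessLib

/-!
# The downstairs Hecke representatives `Bᵢ = δ⁻¹ sᵢ⁻¹ βᵢ δ ∈ Δ₀^{p²M}(q)`: membership, the coset relation
# `(δ⁻¹tᵢδ) B_{σi} = Bᵢ (δ⁻¹γδ)`, and the bijection `i ↦ e(i)` onto the level-`p²M` Hecke index set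

Topic `Literature/NumberTheory/ModularSymbols`; namespace `Literature.NumberTheory.ModularSymbols.FullLevel`; sequel of
`FullLevelHomologyHeckeTransfer` (`sec`, `hcoset`, `transferHecke`).  Definitions with bodies + proved theorems; no named fact,
no `sorry`, no instance, no notation.  This is the integer-matrix half of the comparison «`T_q` on the full-level carrier ↔
`T_q` on `H(p²M; k)`»; the conclusion is drawn in `FullLevelHomologyHeckeComparison`.

* `secBeta i = sᵢ⁻¹βᵢ ∈ Δ₀ᴹ(q)`, `redMat_secBeta` (its reduction is the torus element `redGL(sᵢ)⁻¹β̄ᵢ ∈ T̃`), `dvd_secBeta`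
  (`p ∣` both off-diagonal entries), `secBeta_zero_zero_cast_ne_zero`; **`repDown i = Bᵢ := δ⁻¹(sᵢ⁻¹βᵢ)δ`** and
  **`repDown_mem_delta0`**: `Bᵢ ∈ Δ₀^{p²M}(q)`; **`conjDown_transferHecke_mul_repDown`**: `(δ⁻¹tᵢδ) B_{σ_γ i} = Bᵢ (δ⁻¹γδ)`
  for `γ ∈ Γ_T` (from `γ'ᵢβ_{σi} = βᵢγ`).
* `conjUp_mul`; `exists_repDown_decomp`, **`idxDown i = e(i)`**, **`gDown i = gᵢ ∈ Γ₀(p²M)`** with `gᵢ β_{e(i)} = Bᵢ` (the tree's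
  `existsUnique_mem_delta0_mul_heckeRep` at level `p²M`); `heckeIdx_eq_of_gmat_mul_eq`; **`idxDown_injective`** (conjugating
  back by `δ` and uniqueness of the level-`M` cosets); `heckeIdxEquiv : I_q(M) ≃ I_q(p²M)` (`q ∣ M ↔ q ∣ p²M`);
  **`idxDown_bijective`**, `idxDownEquiv`.

## References
* G. Shimura, *Introduction to the arithmetic theory of automorphic functions* (1971), §3.1 (double cosets and
  representatives), §8.3. [Shimura1971]
* F. Diamond, J. Shurman, *A First Course in Modular Forms* (2005), §1.5, Prop. 5.2.1. [DiamondShurman2005]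
-/

noncomputable section

namespace Literature.NumberTheory.ModularSymbols

namespace FullLevel

open scoped MatrixGroups TensorProduct
open CategoryTheory CongruenceSubgroup groupHomology Finsupp Matrix
open Literature.Algebra.Homology
open Literature.NumberTheory.EllipticCurves.ModularForms

variable (p M : ℕ) [Fact p.Prime] (hpM : Nat.Coprime p M) {q : ℕ} (hq : q.Prime) (hqp : q ≠ p)

/-! ### The downstairs representatives `Bᵢ = δ⁻¹ sᵢ⁻¹ βᵢ δ` -/

/-- The integer matrix `sᵢ⁻¹ βᵢ` (`sᵢ = s(xᵢ)` the section element of the coset `xᵢ = β̄ᵢT̃`). [cite: Shimura1971, §3.1] -/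
def secBeta (i : HeckeIdx M q) : Matrix (Fin 2) (Fin 2) ℤ :=
  HidaCohomology.gmat (sec p M hpM (hcoset p M hq hqp i))⁻¹ * heckeRep q i.1

/-- `sᵢ⁻¹βᵢ ∈ Δ₀ᴹ(q)`. [cite: Shimura1971, §3.1] -/
theorem secBeta_mem_delta0 (i : HeckeIdx M q) : secBeta p M hpM hq hqp i ∈ Delta0 M q := by
  have h := mul_mem_delta0 (coe_mem_delta0_one (sec p M hpM (hcoset p M hq hqp i))⁻¹) (heckeRep_mem_delta0 hq i)
  rwa [one_mul] at h

/-- The reduction of `sᵢ⁻¹βᵢ` mod `p` is the torus element `redGL(sᵢ)⁻¹ β̄ᵢ`. [cite: Shimura1971, §8.3] -/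
theorem redMat_secBeta (i : HeckeIdx M q) (h : (((secBeta p M hpM hq hqp i).det : ℤ) : ZMod p) ≠ 0) :
    redMat p (secBeta p M hpM hq hqp i) h = (redGL p M (sec p M hpM (hcoset p M hq hqp i)))⁻¹ * betaBar p M hq hqp i := by
  have hγ : ∀ δ : Gamma0 M, ((((δ : SL(2, ℤ)) : Matrix (Fin 2) (Fin 2) ℤ).det : ℤ) : ZMod p) ≠ 0 := fun δ => by
    rw [Matrix.SpecialLinearGroup.det_coe, Int.cast_one]; exact one_ne_zero
  show redMat p (HidaCohomology.gmat (sec p M hpM (hcoset p M hq hqp i))⁻¹ * heckeRep q i.1) h = _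
  rw [redMat_mul p _ _ (hγ _) (det_heckeRep_cast_ne_zero p hq hqp i.1) h, redMat_gmat, map_inv, betaBar]

/-- `det (sᵢ⁻¹βᵢ) = q`, a unit mod `p`. [cite: Shimura1971, §3.1] -/
theorem det_secBeta_cast_ne_zero (i : HeckeIdx M q) : (((secBeta p M hpM hq hqp i).det : ℤ) : ZMod p) ≠ 0 := by
  rw [(secBeta_mem_delta0 p M hpM hq hqp i).1, Int.cast_natCast, Ne, ZMod.natCast_eq_zero_iff]
  intro h
  exact hqp (((Nat.prime_dvd_prime_iff_eq (Fact.out : p.Prime) hq).1 h).symm)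

/-- `redGL(sᵢ)⁻¹ β̄ᵢ ∈ T̃` (since `sᵢ·T̃ = β̄ᵢT̃`). [cite: Shimura1971, §8.3] -/
theorem redGL_sec_inv_mul_betaBar_mem (i : HeckeIdx M q) :
    (redGL p M (sec p M hpM (hcoset p M hq hqp i)))⁻¹ * betaBar p M hq hqp i ∈ diagTorus (ZMod p) := by
  have h : redGL p M (sec p M hpM (hcoset p M hq hqp i)) • baseCoset p = betaBar p M hq hqp i • baseCoset p :=
    sec_smul p M hpM (hcoset p M hq hqp i)
  rw [baseCoset, MulAction.Quotient.smul_coe, MulAction.Quotient.smul_coe, smul_eq_mul, smul_eq_mul, mul_one,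
    mul_one, QuotientGroup.eq] at h
  exact h

/-- `p ∣ (sᵢ⁻¹βᵢ)₀₁` and `p ∣ (sᵢ⁻¹βᵢ)₁₀`. [cite: Shimura1971, §8.3] -/
theorem dvd_secBeta (i : HeckeIdx M q) :
    (p : ℤ) ∣ secBeta p M hpM hq hqp i 0 1 ∧ (p : ℤ) ∣ secBeta p M hpM hq hqp i 1 0 := by
  have hmem := redGL_sec_inv_mul_betaBar_mem p M hpM hq hqp i
  rw [← redMat_secBeta p M hpM hq hqp i (det_secBeta_cast_ne_zero p M hpM hq hqp i), mem_diagTorus_iff,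
    redMat_apply, redMat_apply] at hmem
  exact ⟨(ZMod.intCast_zmod_eq_zero_iff_dvd _ p).1 hmem.1, (ZMod.intCast_zmod_eq_zero_iff_dvd _ p).1 hmem.2⟩

/-- `(sᵢ⁻¹βᵢ)₀₀` is a unit mod `p`. [cite: Shimura1971, §8.3] -/
theorem secBeta_zero_zero_cast_ne_zero (i : HeckeIdx M q) : ((secBeta p M hpM hq hqp i 0 0 : ℤ) : ZMod p) ≠ 0 := by
  have hmem := redGL_sec_inv_mul_betaBar_mem p M hpM hq hqp i
  rw [← redMat_secBeta p M hpM hq hqp i (det_secBeta_cast_ne_zero p M hpM hq hqp i)] at hmem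
  have h := (diag_ne_zero_of_mem_diagTorus hmem).1
  rwa [redMat_apply] at h

/-- **The downstairs representative `Bᵢ := δ⁻¹ (sᵢ⁻¹βᵢ) δ`**, an integer matrix. [cite: Shimura1971, §3.1] -/
def repDown (i : HeckeIdx M q) : Matrix (Fin 2) (Fin 2) ℤ := conjDown p (secBeta p M hpM hq hqp i)

/-- `Bᵢ ∈ Δ₀^{p²M}(q)`. [cite: Shimura1971, §3.1] -/
theorem repDown_mem_delta0 (i : HeckeIdx M q) : repDown p M hpM hq hqp i ∈ Delta0 (p ^ 2 * M) ((q : ℤ) * 1) := by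
  obtain ⟨hdet, hc, hcop⟩ := secBeta_mem_delta0 p M hpM hq hqp i
  obtain ⟨hb, hc'⟩ := dvd_secBeta p M hpM hq hqp i
  refine ⟨?_, ?_, ?_⟩
  · rw [mul_one, repDown, det_conjDown _ hb, hdet]
  · rw [repDown, conjDown]
    simp only [Matrix.of_apply, Matrix.cons_val', Matrix.cons_val_zero, Matrix.cons_val_one, Matrix.cons_val_fin_one]
    have hpm : ((p : ℤ) * M) ∣ secBeta p M hpM hq hqp i 1 0 :=
      (Int.isCoprime_iff_gcd_eq_one.2 (by simpa using hpM)).mul_dvd hc' hc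
    obtain ⟨r, hr⟩ := hpm
    exact ⟨r, by rw [hr]; push_cast; ring⟩
  · rw [repDown, conjDown]
    simp only [Matrix.of_apply, Matrix.cons_val', Matrix.cons_val_zero, Matrix.cons_val_fin_one]
    have hp' : IsCoprime (secBeta p M hpM hq hqp i 0 0) (p : ℤ) := by
      rw [isCoprime_comm, Prime.coprime_iff_not_dvd (Nat.prime_iff_prime_int.1 (Fact.out : p.Prime))]
      intro hd
      exact secBeta_zero_zero_cast_ne_zero p M hpM hq hqp i ((ZMod.intCast_zmod_eq_zero_iff_dvd _ p).2 hd)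
    have : ((p ^ 2 * M : ℕ) : ℤ) = (p : ℤ) * ((p : ℤ) * M) := by push_cast; ring
    rw [this]
    exact (hp'.mul_right (hp'.mul_right hcop))

/-- **The coset relation downstairs**: `(δ⁻¹tᵢδ) B_{σ i} = Bᵢ (δ⁻¹γδ)` for `γ ∈ Γ_T`
(from `γ'ᵢ β_{σ i} = βᵢ γ` and `tᵢ = sᵢ⁻¹γ'ᵢs_{σ i}`). [cite: Shimura1971, §3.1 and §8.3] -/
theorem conjDown_transferHecke_mul_repDown (γ : torusLevel p M) (i : HeckeIdx M q) :
    conjDown p (HidaCohomology.gmat (transferHecke p M hpM hq hqp γ.1 i)) * repDown p M hpM hq hqp (heckePerm hq γ.1 i) =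
      repDown p M hpM hq hqp i * conjDown p (HidaCohomology.gmat γ.1) := by
  have hp0 : (p : ℤ) ≠ 0 := by exact_mod_cast (Fact.out : p.Prime).ne_zero
  have ht : (p : ℤ) ∣ HidaCohomology.gmat (transferHecke p M hpM hq hqp γ.1 i) 0 1 :=
    dvd_entry01_of_mem_torusLevel p M (transferHecke_mem p M hpM hq hqp γ.2 i)
  have hγ : (p : ℤ) ∣ HidaCohomology.gmat γ.1 0 1 := dvd_entry01_of_mem_torusLevel p M γ.2
  rw [repDown, repDown, ← conjDown_mul hp0 _ _ ht (dvd_secBeta p M hpM hq hqp _).1,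
    ← conjDown_mul hp0 _ _ (dvd_secBeta p M hpM hq hqp _).1 hγ]
  congr 1
  -- the integer identity `tᵢ (s_{σi}⁻¹ β_{σ i}) = (sᵢ⁻¹ βᵢ) γ`
  set sσ : Gamma0 M := sec p M hpM (hcoset p M hq hqp (heckePerm hq γ.1 i)) with hsσ
  set si : Gamma0 M := sec p M hpM (hcoset p M hq hqp i) with hsi
  have e1 : HidaCohomology.gmat sσ * HidaCohomology.gmat sσ⁻¹ = 1 := by
    rw [← HidaCohomology.gmat_mul, mul_inv_cancel, HidaCohomology.gmat_one]
  have e2 := HidaCohomology.gmat_heckePermElt_mul hq γ.1 i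
  rw [secBeta, secBeta, transferHecke, ← hsσ, ← hsi, HidaCohomology.gmat_mul, HidaCohomology.gmat_mul]
  simp only [Matrix.mul_assoc]
  rw [← Matrix.mul_assoc (HidaCohomology.gmat sσ) (HidaCohomology.gmat sσ⁻¹), e1, Matrix.one_mul, e2]

end FullLevel

end Literature.NumberTheory.ModularSymbols


namespace Literature.NumberTheory.ModularSymbols

namespace FullLevel

open scoped MatrixGroups TensorProduct
open CategoryTheory CongruenceSubgroup groupHomology Finsupp Matrix
open Literature.Algebra.Homology
open Literature.NumberTheory.EllipticCurves.ModularForms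

variable (p M : ℕ) [Fact p.Prime] (hpM : Nat.Coprime p M) {q : ℕ} (hq : q.Prime) (hqp : q ≠ p)

/-! ### `δ A δ⁻¹` is multiplicative; the level-`p²M` decomposition of the `Bᵢ` -/

omit [Fact p.Prime] in
/-- `δ (A B) δ⁻¹ = (δ A δ⁻¹)(δ B δ⁻¹)` when `p ∣ A₁₀`, `p ∣ B₁₀`. [cite: DiamondShurman2005, §1.5] -/
theorem conjUp_mul (hp : (p : ℤ) ≠ 0) (A B : Matrix (Fin 2) (Fin 2) ℤ) (hA : (p : ℤ) ∣ A 1 0) (hB : (p : ℤ) ∣ B 1 0) :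
    conjUp p (A * B) = conjUp p A * conjUp p B := by
  obtain ⟨a, ha⟩ := hA
  obtain ⟨b, hb⟩ := hB
  have e1 : A 1 0 / p = a := by rw [ha, Int.mul_ediv_cancel_left _ hp]
  have e2 : B 1 0 / p = b := by rw [hb, Int.mul_ediv_cancel_left _ hp]
  have e3 : (A 1 0 * B 0 0 + A 1 1 * B 1 0) / p = a * B 0 0 + A 1 1 * b := by
    rw [ha, hb, show p * a * B 0 0 + A 1 1 * (p * b) = p * (a * B 0 0 + A 1 1 * b) by ring,
      Int.mul_ediv_cancel_left _ hp]
  ext i j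
  fin_cases i <;> fin_cases j <;>
    simp [conjUp, Matrix.mul_apply, Fin.sum_univ_two, e1, e2, e3] <;>
    (try rw [ha]) <;> (try rw [hb]) <;> ring

/-- Every `Bᵢ` lies in a unique right coset `Γ₀(p²M) β_j` of the level-`p²M` decomposition. [cite: Shimura1971, §3.1] -/
theorem exists_repDown_decomp (i : HeckeIdx M q) :
    ∃ j : HeckeIdx (p ^ 2 * M) q, ∃ g : Gamma0 (p ^ 2 * M),
      HidaCohomology.gmat g * heckeRep q j.1 = repDown p M hpM hq hqp i := by
  obtain ⟨j, ⟨M', hM', hM'eq⟩, -⟩ :=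
    existsUnique_mem_delta0_mul_heckeRep hq (not_intCast_dvd_one hq) (repDown_mem_delta0 p M hpM hq hqp i)
  obtain ⟨γ, hγ, h⟩ := (exists_mem_delta0_one_iff (N := p ^ 2 * M)
    (fun X => X * heckeRep q j.1 = repDown p M hpM hq hqp i)).1 ⟨M', hM', hM'eq⟩
  exact ⟨j, ⟨γ, hγ⟩, h⟩

/-- The level-`p²M` coset index of `Bᵢ`. [cite: Shimura1971, §3.1] -/
def idxDown (i : HeckeIdx M q) : HeckeIdx (p ^ 2 * M) q := Classical.choose (exists_repDown_decomp p M hpM hq hqp i)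

/-- The element `gᵢ ∈ Γ₀(p²M)` with `Bᵢ = gᵢ β_{e(i)}`. [cite: Shimura1971, §3.1] -/
def gDown (i : HeckeIdx M q) : Gamma0 (p ^ 2 * M) :=
  Classical.choose (Classical.choose_spec (exists_repDown_decomp p M hpM hq hqp i))

/-- `gᵢ β_{e(i)} = Bᵢ`. [cite: Shimura1971, §3.1] -/
theorem gDown_mul (i : HeckeIdx M q) :
    HidaCohomology.gmat (gDown p M hpM hq hqp i) * heckeRep q (idxDown p M hpM hq hqp i).1 = repDown p M hpM hq hqp i :=
  Classical.choose_spec (Classical.choose_spec (exists_repDown_decomp p M hpM hq hqp i))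

include hq in
/-- Uniqueness of the level-`M` coset of `βᵢ`: `Γ₀(M)βᵢ = Γ₀(M)βⱼ ⟹ i = j`. [cite: Shimura1971, §3.1] -/
theorem heckeIdx_eq_of_gmat_mul_eq (δ : Gamma0 M) (i j : HeckeIdx M q)
    (h : HidaCohomology.gmat δ * heckeRep q j.1 = heckeRep q i.1) : i = j := by
  have h1 : heckePerm hq (1 : Gamma0 M) i = j :=
    heckePerm_eq_of_mul_eq hq 1 δ i j (by rw [h]; simp)
  have h2 : heckePerm hq (1 : Gamma0 M) i = i :=
    heckePerm_eq_of_mul_eq hq 1 1 i i (by simp)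
  rw [← h1, h2]

/-- **The coset index map `i ↦ e(i)` is injective** (two `Bᵢ` in the same `Γ₀(p²M)`-coset force `Γ₀(M)βᵢ = Γ₀(M)βⱼ`
after conjugating back by `δ`). [cite: Shimura1971, §3.1] -/
theorem idxDown_injective : Function.Injective (idxDown p M hpM hq hqp) := by
  intro i j hij
  have hp0 : (p : ℤ) ≠ 0 := by exact_mod_cast (Fact.out : p.Prime).ne_zero
  have hi := gDown_mul p M hpM hq hqp i
  have hj := gDown_mul p M hpM hq hqp j
  rw [hij] at hi
  -- `B_i = (g_i g_j⁻¹) B_j`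
  set h : Gamma0 (p ^ 2 * M) := gDown p M hpM hq hqp i * (gDown p M hpM hq hqp j)⁻¹ with hh
  have hB : repDown p M hpM hq hqp i = HidaCohomology.gmat h * repDown p M hpM hq hqp j := by
    rw [← hi, ← hj, ← Matrix.mul_assoc, ← HidaCohomology.gmat_mul, hh, inv_mul_cancel_right]
  -- conjugate back: `s_i⁻¹β_i = (δhδ⁻¹) s_j⁻¹ β_j`
  have hhc : (p : ℤ) ∣ HidaCohomology.gmat h 1 0 :=
    (dvd_mul_right (p : ℤ) (p * M)).trans (by simpa [pow_two, mul_assoc] using dvd_entry10_of_gamma0 (p ^ 2 * M) h)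
  have hBj : (p : ℤ) ∣ repDown p M hpM hq hqp j 1 0 := by
    rw [repDown, conjDown]; simp only [Matrix.of_apply, Matrix.cons_val', Matrix.cons_val_zero, Matrix.cons_val_one,
      Matrix.cons_val_fin_one]; exact dvd_mul_left _ _
  have hS : secBeta p M hpM hq hqp i = conjUp p (HidaCohomology.gmat h) * secBeta p M hpM hq hqp j := by
    have e := congrArg (conjUp p) hB
    rw [repDown, conjUp_conjDown hp0 _ (dvd_secBeta p M hpM hq hqp i).1, conjUp_mul p hp0 _ _ hhc hBj, repDown,
      conjUp_conjDown hp0 _ (dvd_secBeta p M hpM hq hqp j).1] at e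
    exact e
  -- hence `β_i = (s_i u s_j⁻¹) β_j` with `u = δhδ⁻¹ ∈ Γ₀(M)`
  set u : Gamma0 M := ⟨conjUpSL p M h, conjUpSL_mem_gamma0 p M h⟩ with hu
  set si : Gamma0 M := sec p M hpM (hcoset p M hq hqp i)
  set sj : Gamma0 M := sec p M hpM (hcoset p M hq hqp j)
  have hfinal : HidaCohomology.gmat (si * u * sj⁻¹) * heckeRep q j.1 = heckeRep q i.1 := by
    have e2 : HidaCohomology.gmat si * secBeta p M hpM hq hqp i = heckeRep q i.1 := by
      rw [secBeta, ← Matrix.mul_assoc, ← HidaCohomology.gmat_mul, mul_inv_cancel, HidaCohomology.gmat_one, Matrix.one_mul]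
    rw [← e2, hS, secBeta, HidaCohomology.gmat_mul, HidaCohomology.gmat_mul]
    simp only [Matrix.mul_assoc]
    rfl
  exact heckeIdx_eq_of_gmat_mul_eq M hq _ i j hfinal

/-- The two Hecke index sets have the same cardinality (`q ∣ M ↔ q ∣ p²M` for `q ≠ p` prime). [cite: DiamondShurman2005, Prop. 5.2.1] -/
def heckeIdxEquiv : HeckeIdx M q ≃ HeckeIdx (p ^ 2 * M) q where
  toFun i := ⟨i.1, fun h hd => i.2 h (by
    rcases (Nat.Prime.dvd_mul hq).1 hd with h2 | h2
    · exact absurd ((Nat.prime_dvd_prime_iff_eq hq (Fact.out : p.Prime)).1 (hq.dvd_of_dvd_pow h2)) hqp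
    · exact h2)⟩
  invFun j := ⟨j.1, fun h hd => j.2 h (hd.trans (Dvd.intro_left _ rfl))⟩
  left_inv i := Subtype.ext rfl
  right_inv j := Subtype.ext rfl

variable [NeZero q]

/-- `i ↦ e(i)` is a bijection `I_q(M) ≃ I_q(p²M)`. [cite: Shimura1971, §3.1] -/
theorem idxDown_bijective : Function.Bijective (idxDown p M hpM hq hqp) := by
  rw [Fintype.bijective_iff_injective_and_card]
  exact ⟨idxDown_injective p M hpM hq hqp, Fintype.card_congr (heckeIdxEquiv p M hq hqp)⟩

/-- The bijection `e : I_q(M) ≃ I_q(p²M)`. [cite: Shimura1971, §3.1] -/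
def idxDownEquiv : HeckeIdx M q ≃ HeckeIdx (p ^ 2 * M) q := Equiv.ofBijective _ (idxDown_bijective p M hpM hq hqp)

end FullLevel

end Literature.NumberTheory.ModularSymbols
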